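import Literature.AlgebraicGeometry.Morphisms.CechModule
import Literature.AlgebraicGeometry.Modules.PullbackUnitSections
import HarnessLib

/-!
# [OURS · L1 W4.5(b) · T-P1VB part 2a] `Ȟ¹` of a module on a TWO-member family of opens:
# `Ȟ¹((U₀, U₁); M) = Γ(U₀ ∩ U₁, M) / (Γ(U₁, M)| − Γ(U₀, M)|)`

Cell res-hironaka, LADDER-RESOLUTION rung L (D-0089), slot W4.5(b), crux `Theses.EquisingularLift.EquisingularLiftNat`
(stmt-ResolutionOfSingularities-20038) / child `EquisingularLiftNatThree` (stmt-ResolutionOfSingularities-20148); object **T-P1VB**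
(res-L1-w45b-lead-2 BOOK 2026-08-27T09:28:20Z, rung v8 DIR₀ of LEAD-MEMO-5), `--supports stmt-ResolutionOfSingularities-20148 --as helper`.
NOT a statement of any manuscript; OURS plumbing. AI-written; AI review is weaker than expert review.

WHAT. The tree's Čech `Ȟ¹(𝒰; M) = CechMH1 f M U` (`Morphisms/CechModule`, all ORDERED pairs/triples) for a family with TWO
members `U : Fin 2 → X.Opens` (the two standard charts of `ℙ¹` downstream), made explicit:
* `cechDelta f M U : Č⁰ → Γ(U₀ ∩ U₁, M)`, `b ↦ b₁| − b₀|` (the `(0,1)`-component of `d⁰`);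
* `twoCochain y` — the cocycle `(c₀₀, c₀₁, c₁₀, c₁₁) = (0, y, −y, 0)` of `y ∈ Γ(U₀ ∩ U₁, M)` (`twoCochain_mem_cechMZ1`), and
  conversely every cocycle is of this form (`eq_twoCochain_of_mem_cechMZ1`: `z₀₀ = z₁₁ = 0`, `z₁₀ = −z₀₁|`);
* **`subsingleton_cechMH1_iff`**: `Ȟ¹((U₀,U₁); M) = 0 ⟺ ∀ y ∈ Γ(U₀ ∩ U₁, M), ∃ b, y = b₁| − b₀|` — the form in which the
  v8 rung's DOWNSTAIRS hypothesis «Ȟ¹(ℙ¹_k; N_k(−ℓ)) = 0 on the two standard charts» is consumed and can be established;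
* `toQuotRange : Ȟ¹ → Γ(U₀ ∩ U₁, M)/im δ`, `[z] ↦ [z₀₁]`, surjective, whence `moduleFinite_quotient_range_cechDelta`
  (finiteness of `Ȟ¹`, e.g. from the tree's `Morphisms/Devissage`, passes to `coker δ` — the module Nakayama is run on in part 2b).

References (index only): The Stacks Project, Tag 01ED (Čech complex, all ordered tuples); Hartshorne III.4.
-/

noncomputable section

open CategoryTheory AlgebraicGeometry TopologicalSpace Opposite
open Literature.AlgebraicGeometry.Morphisms Literature.AlgebraicGeometry.Modules

universe u

set_option linter.dupNamespace false -- mandated namespace `Summit.<Summit>.<Problem>` of this single-conjunct summit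

namespace Summit.ResolutionOfSingularities.ResolutionOfSingularities.Cruxes.EquisingularLiftNat.P1VB

variable {A : Type u} [CommRing A] {X : Scheme.{u}} (f : X ⟶ Spec (.of A)) (M : X.Modules)
  (U : Fin 2 → X.Opens)

/-! ### The difference map `δ : Γ(U₀, M) × Γ(U₁, M) → Γ(U₀ ∩ U₁, M)` -/

/-- **The `(0,1)`-component of the Čech differential `d⁰`** on a two-member family `U : Fin 2 → X.Opens`:
`δ(b) = b₁|_{U₀ ∩ U₁} - b₀|_{U₀ ∩ U₁}`, an `A`-linear map `Č⁰(𝒰, M) → Γ(U₀ ∩ U₁, M)`. [folklore] -/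
def cechDelta : CechMC0 f M U →ₗ[A] MSections f M (U 0 ⊓ U 1) :=
  (LinearMap.proj (1 : Fin 2) : (∀ j : Fin 2, MSections f M (U 0 ⊓ U j)) →ₗ[A] MSections f M (U 0 ⊓ U 1)) ∘ₗ
    (LinearMap.proj (0 : Fin 2) : CechMC1 f M U →ₗ[A] ∀ j : Fin 2, MSections f M (U 0 ⊓ U j)) ∘ₗ
      cechMD0 f M U

/-- `δ(b) = (d⁰ b)_{01}`. [folklore] -/
theorem cechDelta_eq (b : CechMC0 f M U) : cechDelta f M U b = cechMD0 f M U b 0 1 := rfl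

/-- `δ(b) = b₁| - b₀|`. [folklore] -/
theorem cechDelta_apply (b : CechMC0 f M U) :
    cechDelta f M U b = MSections.res f M inf_le_right (b 1) - MSections.res f M inf_le_left (b 0) := rfl

/-! ### The `1`-cocycle with prescribed `(0,1)`-component -/

/-- **The two-member cocycle of `y ∈ Γ(U₀ ∩ U₁, M)`**: `c₀₁ = y`, `c₁₀ = -y`, `c₀₀ = c₁₁ = 0`. [folklore] -/
def twoCochain (y : MSections f M (U 0 ⊓ U 1)) : CechMC1 f M U := fun i j =>
  if h : i = 0 ∧ j = 1 then MSections.res f M (le_of_eq (by rw [h.1, h.2])) y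
  else if h' : i = 1 ∧ j = 0 then -MSections.res f M (by rw [h'.1, h'.2]; exact le_of_eq (inf_comm (a := U 1) (b := U 0))) y
  else 0

/-- `c₀₁ = y`. [folklore] -/
@[simp]
theorem twoCochain_zero_one (y : MSections f M (U 0 ⊓ U 1)) : twoCochain f M U y 0 1 = y := by
  simp only [twoCochain, and_self, dif_pos]
  exact MSections.res_self f M y

/-- `c₁₀ = -y|_{U₁ ∩ U₀}`. [folklore] -/
@[simp]
theorem twoCochain_one_zero (y : MSections f M (U 0 ⊓ U 1)) :
    twoCochain f M U y 1 0 = -MSections.res f M (le_of_eq (inf_comm (a := U 1) (b := U 0))) y := by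
  simp only [twoCochain, one_ne_zero, zero_ne_one, and_self, dif_neg, not_false_eq_true, dif_pos]

/-- `c₀₀ = 0`. [folklore] -/
@[simp]
theorem twoCochain_zero_zero (y : MSections f M (U 0 ⊓ U 1)) : twoCochain f M U y 0 0 = 0 := by
  simp only [twoCochain, zero_ne_one, and_false, dif_neg, not_false_eq_true, false_and]

/-- `c₁₁ = 0`. [folklore] -/
@[simp]
theorem twoCochain_one_one (y : MSections f M (U 0 ⊓ U 1)) : twoCochain f M U y 1 1 = 0 := by
  simp only [twoCochain, one_ne_zero, false_and, dif_neg, not_false_eq_true, and_false]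

/-- **The two-member cochain of `y` is a cocycle.** [folklore] -/
theorem twoCochain_mem_cechMZ1 (y : MSections f M (U 0 ⊓ U 1)) : twoCochain f M U y ∈ cechMZ1 f M U := by
  rw [mem_cechMZ1_iff]
  funext i j k
  rw [cechMD1_apply, Pi.zero_apply, Pi.zero_apply, Pi.zero_apply]
  revert i j k
  refine Fin.forall_fin_two.mpr ⟨Fin.forall_fin_two.mpr ⟨Fin.forall_fin_two.mpr ⟨?_, ?_⟩,
    Fin.forall_fin_two.mpr ⟨?_, ?_⟩⟩, Fin.forall_fin_two.mpr ⟨Fin.forall_fin_two.mpr ⟨?_, ?_⟩,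
    Fin.forall_fin_two.mpr ⟨?_, ?_⟩⟩⟩ <;>
  simp only [twoCochain_zero_one, twoCochain_one_zero, twoCochain_zero_zero, twoCochain_one_one, map_zero,
    map_neg, MSections.res_res, sub_zero, zero_sub, zero_add, add_zero, sub_self, neg_neg, neg_add_cancel,
    sub_neg_eq_add, add_eq_zero_iff_eq_neg]

/-! ### `Ȟ¹ = 0` on a two-member family: every section over `U₀ ∩ U₁` is a difference -/

/-- **If `Ȟ¹((U₀, U₁); M) = 0` then every `y ∈ Γ(U₀ ∩ U₁, M)` is `b₁| - b₀|`** for some `b_i ∈ Γ(U_i, M)`.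
[folklore] -/
theorem exists_cechDelta_eq_of_subsingleton [Subsingleton (CechMH1 f M U)] (y : MSections f M (U 0 ⊓ U 1)) :
    ∃ b : CechMC0 f M U, cechDelta f M U b = y := by
  have h0 : CechMH1.mk f M U ⟨twoCochain f M U y, twoCochain_mem_cechMZ1 f M U y⟩ = 0 :=
    Subsingleton.elim _ _
  rw [CechMH1.mk_eq_zero_iff] at h0
  obtain ⟨b, hb⟩ := (mem_cechMB1_iff f M U _).mp h0
  refine ⟨b, ?_⟩
  have h : cechMD0 f M U b 0 1 = twoCochain f M U y 0 1 := congrFun (congrFun hb 0) 1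
  rw [twoCochain_zero_one] at h
  exact h

/-! ### Components of a cocycle on a two-member family -/

/-- Restriction along an equality of opens is injective. [folklore] -/
theorem res_injective_of_eq {V W : X.Opens} (h : W = V) :
    Function.Injective (MSections.res f M (le_of_eq h)) := by
  subst h
  intro a b hab
  rwa [MSections.res_self, MSections.res_self] at hab

/-- A cocycle has `z₀₀ = 0`. [folklore] -/
theorem cechMZ1_apply_zero_zero {z : CechMC1 f M U} (hz : z ∈ cechMZ1 f M U) : z 0 0 = 0 := by
  rw [mem_cechMZ1_iff] at hz
  have h := congrFun (congrFun (congrFun hz 0) 0) 0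
  rw [cechMD1_apply, Pi.zero_apply, Pi.zero_apply, Pi.zero_apply, MSections.res_eq_res f M _ inf_le_left,
    sub_self, zero_add] at h
  have e : U 0 ⊓ U 0 ⊓ U 0 = U 0 ⊓ U 0 := inf_eq_left.mpr inf_le_left
  exact res_injective_of_eq f M e (h.trans (map_zero _).symm)

/-- A cocycle has `z₁₁ = 0`. [folklore] -/
theorem cechMZ1_apply_one_one {z : CechMC1 f M U} (hz : z ∈ cechMZ1 f M U) : z 1 1 = 0 := by
  rw [mem_cechMZ1_iff] at hz
  have h := congrFun (congrFun (congrFun hz 1) 1) 1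
  rw [cechMD1_apply, Pi.zero_apply, Pi.zero_apply, Pi.zero_apply, MSections.res_eq_res f M _ inf_le_left,
    sub_self, zero_add] at h
  have e : U 1 ⊓ U 1 ⊓ U 1 = U 1 ⊓ U 1 := inf_eq_left.mpr inf_le_left
  exact res_injective_of_eq f M e (h.trans (map_zero _).symm)

/-- A cocycle has `z₁₀ = -z₀₁|_{U₁ ∩ U₀}`. [folklore] -/
theorem cechMZ1_apply_one_zero {z : CechMC1 f M U} (hz : z ∈ cechMZ1 f M U) :
    z 1 0 = -MSections.res f M (le_of_eq (inf_comm (a := U 1) (b := U 0))) (z 0 1) := by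
  have h00 := cechMZ1_apply_zero_zero f M U hz
  rw [mem_cechMZ1_iff] at hz
  have h := congrFun (congrFun (congrFun hz 0) 1) 0
  rw [cechMD1_apply, Pi.zero_apply, Pi.zero_apply, Pi.zero_apply, h00, map_zero, sub_zero,
    add_eq_zero_iff_eq_neg] at h
  have e : U 0 ⊓ U 1 ⊓ U 0 = U 1 ⊓ U 0 := by
    rw [inf_comm (a := U 0) (b := U 1), inf_assoc, inf_idem]
  refine res_injective_of_eq f M e ?_
  rw [map_neg, MSections.res_res]
  exact h

/-- **A cocycle on a two-member family is the two-member cochain of its `(0,1)`-component.** [folklore] -/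
theorem eq_twoCochain_of_mem_cechMZ1 {z : CechMC1 f M U} (hz : z ∈ cechMZ1 f M U) :
    z = twoCochain f M U (z 0 1) := by
  funext i j
  revert i j
  refine Fin.forall_fin_two.mpr ⟨Fin.forall_fin_two.mpr ⟨?_, ?_⟩, Fin.forall_fin_two.mpr ⟨?_, ?_⟩⟩
  · rw [twoCochain_zero_zero]; exact cechMZ1_apply_zero_zero f M U hz
  · rw [twoCochain_zero_one]
  · rw [twoCochain_one_zero]; exact cechMZ1_apply_one_zero f M U hz
  · rw [twoCochain_one_one]; exact cechMZ1_apply_one_one f M U hz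

/-- **`Ȟ¹((U₀, U₁); M) = 0` iff every section over `U₀ ∩ U₁` is a difference `b₁| - b₀|`.** [folklore] -/
theorem subsingleton_cechMH1_iff :
    Subsingleton (CechMH1 f M U) ↔ ∀ y : MSections f M (U 0 ⊓ U 1), ∃ b : CechMC0 f M U, cechDelta f M U b = y := by
  constructor
  · intro _ y
    exact exists_cechDelta_eq_of_subsingleton f M U y
  · intro h
    refine ⟨fun a b => ?_⟩
    obtain ⟨za, rfl⟩ := CechMH1.mk_surjective f M U a
    obtain ⟨zb, rfl⟩ := CechMH1.mk_surjective f M U b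
    suffices hzero : ∀ z : cechMZ1 f M U, CechMH1.mk f M U z = 0 by rw [hzero, hzero]
    intro z
    rw [CechMH1.mk_eq_zero_iff, mem_cechMB1_iff]
    obtain ⟨c, hc⟩ := h ((z : CechMC1 f M U) 0 1)
    refine ⟨c, ?_⟩
    rw [eq_twoCochain_of_mem_cechMZ1 f M U z.2,
      eq_twoCochain_of_mem_cechMZ1 f M U (cechMB1_le_cechMZ1 f M U ⟨c, rfl⟩), ← cechDelta_eq, hc]

/-! ### The comparison `Ȟ¹((U₀, U₁); M) → Γ(U₀ ∩ U₁, M) / im δ` -/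

/-- **`Ȟ¹((U₀, U₁); M) → Γ(U₀ ∩ U₁, M) / im δ`, `[z] ↦ [z₀₁]`** (an isomorphism; we record that it is a
surjective `A`-linear map). [folklore] -/
def toQuotRange : CechMH1 f M U →ₗ[A] MSections f M (U 0 ⊓ U 1) ⧸ LinearMap.range (cechDelta f M U) :=
  Submodule.liftQ _
    ((Submodule.mkQ _) ∘ₗ
      ((LinearMap.proj (1 : Fin 2) : (∀ j : Fin 2, MSections f M (U 0 ⊓ U j)) →ₗ[A] MSections f M (U 0 ⊓ U 1)) ∘ₗ
        (LinearMap.proj (0 : Fin 2) : CechMC1 f M U →ₗ[A] ∀ j : Fin 2, MSections f M (U 0 ⊓ U j))) ∘ₗ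
      (cechMZ1 f M U).subtype)
    (by
      intro z hz
      rw [Submodule.mem_comap] at hz
      obtain ⟨b, hb⟩ := (mem_cechMB1_iff f M U _).mp hz
      rw [LinearMap.mem_ker, LinearMap.comp_apply, Submodule.mkQ_apply, Submodule.Quotient.mk_eq_zero]
      exact ⟨b, (congrFun (congrFun hb 0) 1 :)⟩)

/-- `toQuotRange [z] = [z₀₁]`. [folklore] -/
theorem toQuotRange_mk (z : cechMZ1 f M U) :
    toQuotRange f M U (CechMH1.mk f M U z) = Submodule.Quotient.mk ((z : CechMC1 f M U) 0 1) := rfl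

/-- **`toQuotRange` is surjective.** [folklore] -/
theorem toQuotRange_surjective : Function.Surjective (toQuotRange f M U) := by
  intro q
  obtain ⟨y, rfl⟩ := Submodule.Quotient.mk_surjective _ q
  refine ⟨CechMH1.mk f M U ⟨twoCochain f M U y, twoCochain_mem_cechMZ1 f M U y⟩, ?_⟩
  change Submodule.Quotient.mk (twoCochain f M U y 0 1) = Submodule.Quotient.mk y
  rw [twoCochain_zero_one]

/-- **Finiteness transfer**: if `Ȟ¹((U₀, U₁); M)` is a finite `A`-module then so is `Γ(U₀ ∩ U₁, M) / im δ`.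
[folklore] -/
theorem moduleFinite_quotient_range_cechDelta [Module.Finite A (CechMH1 f M U)] :
    Module.Finite A (MSections f M (U 0 ⊓ U 1) ⧸ LinearMap.range (cechDelta f M U)) :=
  Module.Finite.of_surjective (toQuotRange f M U) (toQuotRange_surjective f M U)

end Summit.ResolutionOfSingularities.ResolutionOfSingularities.Cruxes.EquisingularLiftNat.P1VB

end
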